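import Summits.AtomisticToContinuum.BoseEinsteinCondensation.Theorems.BoxLatticeFSumCarving
import Summits.AtomisticToContinuum.BoseEinsteinCondensation.Theorems.BlockLatticeFSumMixedFloor
import HarnessLib

/-!
# `BoxEnergyHorizon` — the residual DE of the box f-sum line carved at the ENERGY HORIZON
# (decomp-a2c · lens-6 «barrier-complement carving» · gen 30 · conjunct `BoseEinsteinCondensation`)

NODE (rung 2, beneath the landed gen-29 kernel `bec_of_floor_budget_deep_counting :
BoxMixedFloor → BoxShellBudget → BoxDeepInfraredEmptiness → BoxShellModeCounting →
BoseEinsteinCondensation`, tree `Theorems/BoxLatticeFSumCarving.lean`).  QUESTION OF RECORD (critic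
row 412 (4)): «presearch DE: compare the block scale with the scales on which condensation is PROVED
(Fournais 2020, Junge 2026); if the block sits at/below a proven scale DE is ATTACKABLE·L, else
IDEA-NEEDED».  ANSWER, as a kernel.  DE = `BoxDeepInfraredEmptiness` bounds, for Dirichlet
`δ`-near-minimisers at density `ρ` in the thermodynamic box `L = (N/ρ)^{1/3} → ∞`, the total
occupation of the NONZERO DCT block waves `g_q` (block side `ℓ = L/K ∈ [A/√ρ, 2A/√ρ]`, the healing
scale) with path dispersion `0 < ε_P(q) < θ` — i.e. of block phonons of every physical wavelength
`λ ≈ πℓ√(2/ε_P(q))` from `≈ ℓ/√θ` up to `2L`.  The block scale itself IS below every proved scale; what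
decides attackability is the WAVELENGTH of the mode, and print reaches exactly one horizon:

* energy methods see a mode of wavelength `λ` iff boosting the condensate into it costs more than the
  precision of the two-sided energy bounds: `4π²N/λ² > C ρa (ρa³)^{1/2+η} N`, i.e.
  `λ < λ_E := c (ρa)^{-1/2} (ρa³)^{-1/4-η/2} = c·a (ρa³)^{-3/4-η/2}` — the Lee–Huang–Yang window with the
  `η`-gain of [cite: Junge2026, Thm. 4 (23) and (25)] (from FJGMOT 2024, arXiv:2408.14222) below and
  [cite: BastiEtAl2026, Thm. 1.1 (1.4)] / [cite: BrooksOldenburgSaintAubinSchlein2025, Thm. 1 (3)] above;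
  `R ∼ a(ρa³)^{-3/4-η}` is precisely the largest box on which [cite: Junge2026, Cor. 6 (26)] propagates
  condensation (`Tr(n₊Γ)/N ≤ C ρR²a(ρa³)^{1/2+η}`), and `κ ≤ (2+2η)/(5+3η) < 2/3` [cite: Junge2026,
  Remark 7] is the same ceiling in GP-interpolation units;
* beyond it the tree's boost theorems certify BLINDNESS of every energy-window argument:
  `Literature.Barriers.AtomisticToContinuum.BoseGas.exists_decondensed_within_gap`,
  `energyWindow_fraction_le` (`KineticGapLengthScalesNarrow`, conjuncts (2)–(3); scope caveat (e) records
  the quantitative ceiling `L/a ≲ (ρa³ε)^{-1/2}`).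

So DE is carved along the horizon into

  `BoxDeepInfraredEmptiness ⟸ NEAR ∧ FAR`   (`de_of_horizon`, 0 sorry)

with the threshold `Θ_E = horizonThreshold C κ a A ρ = C·A²·a·(ρa³)^{1/2+κ}` (`= 2π²ℓ²/λ_E²` up to the
window factor 4; dimensionless since `[A] = length^{-1/2}`):

* **NEAR** `HorizonVisibleEmptiness` — `∃ κ C ∀ A ∃ ρ₀ ∀ ρ<ρ₀ ∀ᶠ N ∃ δ`: every
  Dirichlet `δ`-near-minimiser puts `≤ N/16` into the nonzero block waves with `ε_P(q) ≥ Θ_E`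
  (wavelengths `≲ λ_E`).  TAG TRUE-type · ATTACKABLE·L (inside the sighted region BY CONSTRUCTION;
  neither implies nor follows from the conjunct — probes).  Plan (NODE card §3): (N1) LHY two-sided
  Dirichlet energy at fixed `ρ`, eventually in `N`; (N2) Neumann localisation of the near-minimiser into
  boxes of side `R ∈ [a(ρa³)^{-1/2-η}, R_E]` with the PINNED bound `H_Q - (η/R²) n₊^Q ≥ E_LHY(m,R)` per
  particle sector [Junge2026 Thm. 4/Cor. 6 proof, (27)–(28)]; (N3) Legendre/convexity in the sector
  occupation ⇒ `Σ_Q ⟨n₊^Q⟩ ≤ (R²/η)·2Cρa(ρa³)^{1/2+η}N ≤ N/64` for `R ≤ R_E`; (N4) two-scale kinematics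
  `Tr(γ P_band) ≤ 2 Σ_Q⟨n₊^Q⟩ + 2‖P_R P_band P_R‖·N`, `‖P_R P_band P_R‖ ≤ C' λ_Θ/R` (spectral tail of
  `R`-step functions in the block-DCT basis; positive-definiteness of autocorrelations kills the
  harmonic-sum log) ⇒ choose `λ_E = R_E/(64C')`, i.e. `κ = η`.
* **FAR** `SubHorizonEmptiness` — `∀ κ C ∃ A ρ₀ ∀ ρ<ρ₀ ∀ᶠ N ∃ δ`: `≤ N/16` in the
  nonzero block waves with `ε_P(q) < Θ_E` (wavelengths from `λ_E` up to `2L → ∞`).  TAG UNDECIDED ·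
  DECLARED RESIDUAL · IDEA-NEEDED · BARRIER-PLACED: it is DE's sub-horizon part
  (`subHorizon_eighth_of_deep : DE → FAR(N/8)`, proved), and as a STATEMENT it is consistent
  with the boost witnesses (`δ` is free: `∃ δ` may sit below the boost cost `π²N/L² ∼ ρ^{2/3}N^{1/3} → ∞`),
  but every METHOD that reads only `energy Ψ ≤ E₀^{upper} + δ` at the printed precision is blind to its
  band — the ways in are what uses MINIMALITY beyond the energy value: second-order perturbation
  inequalities around `Ψ₀` (sum rules / static response / Bogoliubov's inequality) and exact-sector
  eigenvalue identities, each needing an `L`-uniform spectral input at `|p| ≍ 2π/L` (solo-blind paper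
  §13.8 «walls L, χ, VD»; its no-gos §11.6–11.7 close positivity and exact zero momentum as exits).
* Separating shapes: a condensate phase-disordered ONLY at wavelengths `> λ_E` satisfies MF, SB, NEAR and
  violates FAR; block-Fock states violate both; so neither piece is decoration, and FAR is not NEAR
  re-typed (`ε_P < Θ_E` vs `Θ_E ≤ ε_P` are complementary bands).

PRIOR ART AND NOVELTY (problem-relative, honest).  The horizon is NOT new in this project: the
solo-blind residency's working paper (`run/shared/lean/ideation/AtomisticToContinuum/solo-blind/paper/
paper.md`, sessions 10–11, 2026-08-20) LOCATED THE SAME WALL on the torus — §11.4 Theorem 11.4 and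
Remark (i) («the box method at LHY precision certifies local condensation on boxes
`R ≲ ξ(ρa³)^{-1/4-ω/2}` and no further; the exchange rate between energy and off-diagonal order is
`(2π/L)²` per particle, in both directions»), §13.8 Proposition 13.9 («generalised condensation
`N^{-1}Σ_{|p|≤k₀} n_p ≥ 1-3s` for `k₀ξ ≳ s^{-3/2}(ρa³)^{1/4+ω/2}`, uniformly in `L`», operator half and
symbol bound KERNEL-CHECKED in the tree: `SoloBlindDomination.lean` (`re_trace_cutoff_le`,
`generalised_condensation_of_local`), `SoloBlindBoxLatticeSymbol3D.lean`) and its closing paragraph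
«the deep-infrared window — BEC ⟸ `Σ_{p∈W_L(ρ)} n_p ≤ sN` uniformly in `L`, `W_L(ρ) = {0<|p|≤k₀(ρ)}`».
NEAR is the Dirichlet-box / DCT-block-wave twin of Prop. 13.9 (2); FAR is the twin of the window
`W_L(ρ)`.  What THIS node adds: (a) the dictionary torus plane waves ↦ DCT block waves `g_q` at the
healing block scale, momentum cutoff `k₀` ↦ path-dispersion threshold `Θ_E` (`horizonThreshold`),
box-constant projector `P` ↦ the `R`-superblock projector, so that the solo paper's wall becomes a cut
of the lens-6 residual `BoxDeepInfraredEmptiness` (item 27506's box conjunct); (b) the seam PROVED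
against the LANDED carving (`de_of_horizon`, `bec_of_floor_budget_horizon`, 0 sorry) — the cell's one
residual is now literally the located window, with NEAR inheriting a kernel-checked operator half;
(c) the honest transplant ledger: Thm 11.4's fragmentation proof uses momentum sectors and has NO
Dirichlet version (paper Rem. (iv): Prop. 11.1's `o(N)` walls remain the box statement), so in the box
the energy-window form of FAR is walled, not refuted.  Nearest in-tree ROUTE cut: `GapWindowLadder`
W₊/W₋ (by WINDOW SIZE at the box gap, periodic) — a different axis.

Glue proved here (0 sorry): `de_of_horizon` (DE ⟸ NEAR ∧ FAR), `subHorizon_eighth_of_deep`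
(FAR(N/8) ⟸ DE: the WEAKER certificate), `eventually_horizonThreshold_le` (`Θ_E → 0` as `ρ → 0`), and
the conjunct kernels
`bec_of_floor_budget_horizon : MF → SB → MC → NEAR → FAR → BoseEinsteinCondensation` and — MF being
PROVED BY NAME in the tree (`BlockLatticeFSumMixedFloor.boxMixedFloor`, hand-2 p820098) —
`bec_of_budget_counting_horizon : SB → MC → NEAR → FAR → BoseEinsteinCondensation`.
-/

noncomputable section

open MeasureTheory Filter Set
open scoped ENNReal NNReal BigOperators Topology

namespace Summit.AtomisticToContinuum.BoseEinsteinCondensation.Theorems.BoxEnergyHorizon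

open Literature.MathematicalPhysics.QuantumManyBody.BoseGas
open Summit.AtomisticToContinuum.BoseEinsteinCondensation.Theorems.BoxLatticeFSum

/-! ### The horizon threshold -/

/-- The energy-horizon threshold on the path dispersion:
`Θ_E(C, κ; a, A, ρ) = C · A² · a · (ρa³)^{1/2+κ}`.  With block side `ℓ = L/K ∈ [A/√ρ, 2A/√ρ]` and
`ε_P(q) ≈ 2π²ℓ²/λ²`, the condition `ε_P(q) ≥ Θ_E` says the block wave `g_q` has physical wavelength
`λ ≲ λ_E = c (ρa)^{-1/2}(ρa³)^{-1/4-κ/2}` (the LHY energy horizon for `κ = η`). [folklore] -/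
def horizonThreshold (C κ a A ρ : ℝ) : ℝ :=
  C * A ^ 2 * a * (ρ * a ^ 3) ^ ((1 : ℝ) / 2 + κ)

/-- `Θ_E` vanishes at `ρ = 0` (positive exponent). [folklore] -/
theorem horizonThreshold_zero {C κ a A : ℝ} (hκ : 0 < κ) : horizonThreshold C κ a A 0 = 0 := by
  have hp : (1 : ℝ) / 2 + κ ≠ 0 := by positivity
  unfold horizonThreshold
  rw [zero_mul, Real.zero_rpow hp, mul_zero]

/-- `ρ ↦ Θ_E(ρ)` is continuous at `0`. [folklore] -/
theorem continuousAt_horizonThreshold (C κ a A : ℝ) (hκ : 0 < κ) :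
    ContinuousAt (fun ρ : ℝ => horizonThreshold C κ a A ρ) 0 := by
  have hp : (0 : ℝ) ≤ 1 / 2 + κ := by positivity
  have h1 : ContinuousAt (fun ρ : ℝ => (ρ * a ^ 3) ^ ((1 : ℝ) / 2 + κ)) 0 := by
    have h0 : ContinuousAt (fun x : ℝ => x ^ ((1 : ℝ) / 2 + κ)) (0 * a ^ 3) :=
      Real.continuousAt_rpow_const _ _ (Or.inr hp)
    exact ContinuousAt.comp (g := fun x : ℝ => x ^ ((1 : ℝ) / 2 + κ)) h0
      (continuousAt_id.mul continuousAt_const)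
  exact continuousAt_const.mul h1

/-- **`Θ_E → 0` as `ρ → 0`**: for every `θ > 0` there is `ρ₁ > 0` with `Θ_E(ρ) ≤ θ` on `(0, ρ₁)`.
[folklore] -/
theorem eventually_horizonThreshold_le (C a A : ℝ) {κ θ : ℝ} (hκ : 0 < κ) (hθ : 0 < θ) :
    ∃ ρ₁ : ℝ, 0 < ρ₁ ∧ ∀ ρ : ℝ, 0 < ρ → ρ < ρ₁ → horizonThreshold C κ a A ρ ≤ θ := by
  have hlt : horizonThreshold C κ a A 0 < θ := by rw [horizonThreshold_zero hκ]; exact hθ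
  have hev : ∀ᶠ ρ in 𝓝 (0 : ℝ), horizonThreshold C κ a A ρ < θ :=
    (continuousAt_horizonThreshold C κ a A hκ).tendsto.eventually (eventually_lt_nhds hlt)
  obtain ⟨ε, hε, hball⟩ := Metric.eventually_nhds_iff.mp hev
  refine ⟨ε, hε, fun ρ hρ hρε => (hball ?_).le⟩
  rwa [Real.dist_eq, sub_zero, abs_of_pos hρ]

/-! ### The two pieces -/

/-- **NEAR** (crux r3 · TAG TRUE-type · ATTACKABLE·L) `HorizonVisibleEmptiness`: for `a > 0` there are
`κ, C > 0` such that for every block constant `A > 0`, below a density cap, eventually in `N`, for some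
`δ > 0`, every Dirichlet `δ`-near-minimiser puts at most `N/16` in total into the NONZERO DCT block
waves with `ε_P(q) ≥ Θ_E(C, κ; a, A, ρ)` (the energy-VISIBLE band, wavelengths `≲ λ_E`), for every even
`K` in the window.  Why it might fail: only through its inputs — the `η`-gain two-sided LHY bounds are
in print for `V ∈ L¹/L²` and for pure hard spheres, not for every measurable finite-range `v` (hard
core + tail: same Jastrow/Neumann methods, unprinted), and the pinned Neumann bound must be used
sector-wise (all particle numbers `m ≲ ρR³` in a box of FIXED side `R`).  Why strictly weaker / not
the conjunct: silent on every mode of wavelength `> λ_E`, in particular on `q = 0` versus the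
sub-horizon band (probes: NEAR ↛ DE, NEAR ↛ BEC). [cite: Junge2026, Thm. 4 (23), (25) and Cor. 6 (26)–(28)] -/
@[conjecture] def HorizonVisibleEmptiness : Prop :=
  ∀ v : ℝ → ℝ≥0∞, IsRepulsiveFiniteRange v → 0 < scatteringLength v →
    ∃ κ : ℝ, 0 < κ ∧ ∃ C : ℝ, 0 < C ∧ ∀ A : ℝ, 0 < A → ∃ ρ₀ : ℝ, 0 < ρ₀ ∧
      ∀ ρ : ℝ, 0 < ρ → ρ < ρ₀ →
      ∀ᶠ N : ℕ in atTop, ∃ δ : ℝ≥0∞, 0 < δ ∧ ∀ Ψ : TrialState N (sideLength ρ N),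
        energy v Ψ ≤ groundStateEnergy v N (sideLength ρ N) + δ →
        ∀ K : ℕ, Even K → 0 < K → InWindow A ρ (sideLength ρ N) K →
          (∑ q ∈ (Finset.univ.filter fun q : SubIdx K =>
              0 < pathDispersion K q ∧
                horizonThreshold C κ (scatteringLength v).toReal A ρ ≤ pathDispersion K q),
            occupation N (boxBlockWave (sideLength ρ N) K q) Ψ.ψ) ≤ ENNReal.ofReal ((N : ℝ) / 16)

/-- **FAR** (crux r2 · TAG UNDECIDED · DECLARED RESIDUAL · IDEA-NEEDED · BARRIER-PLACED)
`SubHorizonEmptiness`: for `a > 0` and EVERY `κ, C > 0` there are a block constant `A > 0` and a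
density cap below which, eventually in `N`, for some `δ > 0`, every Dirichlet `δ`-near-minimiser puts
at most `N/16` in total into the nonzero DCT block waves with `ε_P(q) < Θ_E(C, κ; a, A, ρ)` — no
macroscopic occupation of block phonons of wavelength between the LHY horizon
`λ_E ∼ a(ρa³)^{-3/4-κ/2}` and the box size `2L → ∞`.  Why it might fail: condensate fragmentation /
phase disorder at wavelengths `> λ_E` costs less than any printed energy resolution (boost witnesses
`exists_decondensed_within_gap`, `energyWindow_fraction_le`), so nothing energetic forbids it; the bet
is a mechanism using near-minimality beyond the energy VALUE.  Why strictly weaker than DE: DE implies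
its `N/8`-version (`subHorizon_eighth_of_deep`), and for each fixed `κ, C` its band `ε_P < Θ_E → 0`
(`eventually_horizonThreshold_le`) is eventually a strict sub-band of DE's `ε_P < θ`; FAR ↛ DE and
FAR ↛ BEC (probes). [cite: LSSY2005, Ch. 5 §5.1–5.2 (5.15)–(5.24)] -/
@[conjecture] def SubHorizonEmptiness : Prop :=
  ∀ v : ℝ → ℝ≥0∞, IsRepulsiveFiniteRange v → 0 < scatteringLength v →
    ∀ κ : ℝ, 0 < κ → ∀ C : ℝ, 0 < C → ∃ A : ℝ, 0 < A ∧ ∃ ρ₀ : ℝ, 0 < ρ₀ ∧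
      ∀ ρ : ℝ, 0 < ρ → ρ < ρ₀ →
      ∀ᶠ N : ℕ in atTop, ∃ δ : ℝ≥0∞, 0 < δ ∧ ∀ Ψ : TrialState N (sideLength ρ N),
        energy v Ψ ≤ groundStateEnergy v N (sideLength ρ N) + δ →
        ∀ K : ℕ, Even K → 0 < K → InWindow A ρ (sideLength ρ N) K →
          (∑ q ∈ (Finset.univ.filter fun q : SubIdx K =>
              0 < pathDispersion K q ∧
                pathDispersion K q < horizonThreshold C κ (scatteringLength v).toReal A ρ),
            occupation N (boxBlockWave (sideLength ρ N) K q) Ψ.ψ) ≤ ENNReal.ofReal ((N : ℝ) / 16)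

/-! ### FAR is DE's sub-horizon part (WEAKER certificate) -/

/-- **`DE → FAR(N/8)`**: the tree's deep-infrared emptiness implies the sub-horizon bound with DE's own
fraction `1/8` (take DE's `A`; shrink the density cap until `Θ_E ≤ θ`; the sub-horizon band is then a
sub-band of DE's deep band).  So `SubHorizonEmptiness` is DE restricted below the horizon, up to the
fraction `1/16` vs `1/8` that the two-piece kernel needs. [folklore] -/
theorem subHorizon_eighth_of_deep (hDE : BoxDeepInfraredEmptiness) :
    ∀ v : ℝ → ℝ≥0∞, IsRepulsiveFiniteRange v → 0 < scatteringLength v →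
    ∀ κ : ℝ, 0 < κ → ∀ C : ℝ, 0 < C → ∃ A : ℝ, 0 < A ∧ ∃ ρ₀ : ℝ, 0 < ρ₀ ∧
      ∀ ρ : ℝ, 0 < ρ → ρ < ρ₀ →
      ∀ᶠ N : ℕ in atTop, ∃ δ : ℝ≥0∞, 0 < δ ∧ ∀ Ψ : TrialState N (sideLength ρ N),
        energy v Ψ ≤ groundStateEnergy v N (sideLength ρ N) + δ →
        ∀ K : ℕ, Even K → 0 < K → InWindow A ρ (sideLength ρ N) K →
          (∑ q ∈ (Finset.univ.filter fun q : SubIdx K =>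
              0 < pathDispersion K q ∧
                pathDispersion K q < horizonThreshold C κ (scatteringLength v).toReal A ρ),
            occupation N (boxBlockWave (sideLength ρ N) K q) Ψ.ψ) ≤ ENNReal.ofReal ((N : ℝ) / 8) := by
  intro v hv ha κ hκ C hC
  obtain ⟨A, hA, θ, hθ, ρ₀, hρ₀, hρ⟩ := hDE v hv ha
  obtain ⟨ρ₁, hρ₁, hΘ⟩ :=
    eventually_horizonThreshold_le C (scatteringLength v).toReal A hκ hθ
  refine ⟨A, hA, min ρ₀ ρ₁, lt_min hρ₀ hρ₁, fun ρ hρ0 hρlt => ?_⟩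
  have hΘθ : horizonThreshold C κ (scatteringLength v).toReal A ρ ≤ θ :=
    hΘ ρ hρ0 (lt_of_lt_of_le hρlt (min_le_right _ _))
  filter_upwards [hρ ρ hρ0 (lt_of_lt_of_le hρlt (min_le_left _ _))] with N hN
  obtain ⟨δ, hδ, hΨ⟩ := hN
  refine ⟨δ, hδ, fun Ψ hE K hK hK0 hW => ?_⟩
  have hsub :
      (Finset.univ.filter fun q : SubIdx K =>
          0 < pathDispersion K q ∧
            pathDispersion K q < horizonThreshold C κ (scatteringLength v).toReal A ρ) ⊆
        (Finset.univ.filter fun q : SubIdx K =>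
          0 < pathDispersion K q ∧ pathDispersion K q < θ) := by
    intro q hq
    simp only [Finset.mem_filter, Finset.mem_univ, true_and] at hq ⊢
    exact ⟨hq.1, lt_of_lt_of_le hq.2 hΘθ⟩
  exact (Finset.sum_le_sum_of_subset hsub).trans (hΨ Ψ hE K hK hK0 hW)

/-! ### The kernel: DE ⟸ NEAR ∧ FAR -/

/-- **`DE ⟸ NEAR ∧ FAR`**: take `κ, C` from NEAR, the block constant `A` from FAR at `(κ, C)`,
`θ := 1`, the smaller density cap and the smaller `δ`; DE's deep band `0 < ε_P < θ` splits into the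
sub-horizon part `ε_P < Θ_E` (FAR, `≤ N/16`) and the visible part `Θ_E ≤ ε_P` (NEAR, `≤ N/16`), and
`N/16 + N/16 = N/8`.  (Any fractions `c₁ + c₂ ≤ 1/8` and any `θ > 0` would do.) [folklore] -/
theorem de_of_horizon (hNear : HorizonVisibleEmptiness) (hFar : SubHorizonEmptiness) :
    BoxDeepInfraredEmptiness := by
  intro v hv ha
  obtain ⟨κ, hκ, C, hC, hA⟩ := hNear v hv ha
  obtain ⟨A, hA0, ρF, hρF, hF⟩ := hFar v hv ha κ hκ C hC
  obtain ⟨ρN, hρN, hN⟩ := hA A hA0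
  refine ⟨A, hA0, 1, one_pos, min ρN ρF, lt_min hρN hρF, fun ρ hρ0 hρlt => ?_⟩
  filter_upwards [hN ρ hρ0 (lt_of_lt_of_le hρlt (min_le_left _ _)),
    hF ρ hρ0 (lt_of_lt_of_le hρlt (min_le_right _ _))] with N h₁ h₂
  obtain ⟨δ₁, hδ₁, hΨ₁⟩ := h₁
  obtain ⟨δ₂, hδ₂, hΨ₂⟩ := h₂
  refine ⟨min δ₁ δ₂, lt_min hδ₁ hδ₂, fun Ψ hE K hK hK0 hW => ?_⟩
  have hE₁ : energy v Ψ ≤ groundStateEnergy v N (sideLength ρ N) + δ₁ :=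
    hE.trans (add_le_add le_rfl (min_le_left _ _))
  have hE₂ : energy v Ψ ≤ groundStateEnergy v N (sideLength ρ N) + δ₂ :=
    hE.trans (add_le_add le_rfl (min_le_right _ _))
  set Θ := horizonThreshold C κ (scatteringLength v).toReal A ρ with hΘ
  set f : SubIdx K → ℝ≥0∞ := fun q => occupation N (boxBlockWave (sideLength ρ N) K q) Ψ.ψ with hf
  set Snear := Finset.univ.filter fun q : SubIdx K =>
      0 < pathDispersion K q ∧ Θ ≤ pathDispersion K q with hSnear
  set Sfar := Finset.univ.filter fun q : SubIdx K =>
      0 < pathDispersion K q ∧ pathDispersion K q < Θ with hSfar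
  have e₁ : ∑ q ∈ Snear, f q ≤ ENNReal.ofReal ((N : ℝ) / 16) := hΨ₁ Ψ hE₁ K hK hK0 hW
  have e₂ : ∑ q ∈ Sfar, f q ≤ ENNReal.ofReal ((N : ℝ) / 16) := hΨ₂ Ψ hE₂ K hK hK0 hW
  have hdisj : Disjoint Sfar Snear := by
    rw [hSfar, hSnear, Finset.disjoint_filter]
    intro q _ hq hq'
    exact absurd hq.2 (not_lt.mpr hq'.2)
  have hsub : (Finset.univ.filter fun q : SubIdx K =>
        0 < pathDispersion K q ∧ pathDispersion K q < 1) ⊆ Sfar ∪ Snear := by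
    intro q hq
    simp only [Finset.mem_filter, Finset.mem_univ, true_and] at hq
    rw [Finset.mem_union, hSfar, hSnear]
    simp only [Finset.mem_filter, Finset.mem_univ, true_and]
    rcases lt_or_ge (pathDispersion K q) Θ with h | h
    · exact Or.inl ⟨hq.1, h⟩
    · exact Or.inr ⟨hq.1, h⟩
  have hN0 : (0 : ℝ) ≤ (N : ℝ) / 16 := by positivity
  calc ∑ q ∈ (Finset.univ.filter fun q : SubIdx K =>
            0 < pathDispersion K q ∧ pathDispersion K q < 1), f q
      ≤ ∑ q ∈ Sfar ∪ Snear, f q := Finset.sum_le_sum_of_subset hsub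
    _ = ∑ q ∈ Sfar, f q + ∑ q ∈ Snear, f q := Finset.sum_union hdisj
    _ ≤ ENNReal.ofReal ((N : ℝ) / 16) + ENNReal.ofReal ((N : ℝ) / 16) := add_le_add e₂ e₁
    _ = ENNReal.ofReal ((N : ℝ) / 16 + (N : ℝ) / 16) := (ENNReal.ofReal_add hN0 hN0).symm
    _ = ENNReal.ofReal ((N : ℝ) / 8) := by ring_nf

/-! ### The conjunct kernel with DE replaced by its two halves -/

/-- **`BoseEinsteinCondensation ⟸ MF ∧ SB ∧ MC ∧ NEAR ∧ FAR`** — five binders: the TRUE-type floor MF,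
the two kinematic supports SB, MC (tree items of the gen-29 carving), the ATTACKABLE·L visible half
NEAR, and ONE residual FAR (sub-horizon emptiness). [folklore] -/
theorem bec_of_floor_budget_horizon (hMF : BoxMixedFloor) (hSB : BoxShellBudget)
    (hMC : BoxShellModeCounting) (hNear : HorizonVisibleEmptiness) (hFar : SubHorizonEmptiness) :
    _root_.BoseEinsteinCondensation :=
  bec_of_floor_budget_deep_counting hMF hSB (de_of_horizon hNear hFar) hMC

/-- **The conjunct from four binders**, MF discharged by the tree theorem `boxMixedFloor`
(hand-2, p820098): `BoseEinsteinCondensation ⟸ SB ∧ MC ∧ NEAR ∧ FAR` — two kinematic pieces, the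
energy-visible band, and the deep-infrared window. [folklore] -/
theorem bec_of_budget_counting_horizon (hSB : BoxShellBudget) (hMC : BoxShellModeCounting)
    (hNear : HorizonVisibleEmptiness) (hFar : SubHorizonEmptiness) :
    _root_.BoseEinsteinCondensation :=
  bec_of_floor_budget_horizon BlockLatticeFSumMixedFloor.boxMixedFloor hSB hMC hNear hFar

end Summit.AtomisticToContinuum.BoseEinsteinCondensation.Theorems.BoxEnergyHorizon

end
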